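import Literature.Computability.Cryptography.HallgrenClassGroupHowell
import Literature.Computability.Cryptography.HallgrenClassGroupXgcdFP
import HarnessLib

/-!
# Hallgren 2005 / class numbers under GRH — programming step P10: the subgroup-order algorithm on
# residue rows in `CodeFP`

Topic `Literature/Computability/Cryptography`; proof companion of `HallgrenClassGroup.lean`
(named fact `Hallgren2005_classNumber_qsolvable_of_GRH`). Definitions and theorems; no named fact.
The algorithm `Howell.subgroupOrderPure N k rows` (`HallgrenClassGroupHowell.lean`) — Bezout
elimination on the first column, the order of the pivot and of its complement row, recursion on the
remaining columns — as a typed polynomial-time map (`CodeFP`, Arora–Barak 2009, §1.3): vector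
operations `mod M` with `M = max N 1` (`zmulKC`, `vaddKC`, `bezoutPairNC`), the elimination pass as a
fold (`elimStep`, `foldl_elimStep`, `elimFoldNC`), orders (`ordNC`, `listLcmC`, `ordVecNC`), one level
of the recursion (`levelStepH`, `iterate_levelStepH`) and **`subgroupOrderPureC`**. All accumulator
bounds are honest: computed rows have `n` entries `< M`, the lcm of a list is at most the product,
the product of the level factors is at most `M^k`.

## References

* K. K. H. Cheung, M. Mosca, QIC 1 (2001), §3 [CheungMosca2001].
* S. Arora, B. Barak, *Computational Complexity: A Modern Approach*, CUP 2009, §1.3 [AroraBarak2009].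
-/

noncomputable section

namespace Literature.Computability.Cryptography.Hallgren2005

namespace HowellFP

open Literature.Computability.Complexity Literature.Computability.Complexity.CodeFP Polynomial Howell ClFP

/-- Rows and row lists on codes. [folklore] -/
abbrev rowE : List ℕ → List Bool := rawE natE
/-- Row lists on codes. [folklore] -/
abbrev rowsE : List (List ℕ) → List Bool := rawE rowE

/-- The working modulus `M = max N 1`. [folklore] -/
def gN (N : ℕ) : ℕ := max N 1

/-- `gN N ≥ 1`. [folklore] -/
theorem gN_pos (N : ℕ) : 0 < gN N := by unfold gN; omega

/-- `gN N = N` for `N ≠ 0`. [folklore] -/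
theorem gN_eq {N : ℕ} (h : N ≠ 0) : gN N = N := by unfold gN; omega

/-! ### Size bookkeeping for rows -/

/-- The code length of a row with `n` entries below `M`. [folklore] -/
theorem length_rowE_le {M n : ℕ} {v : List ℕ} (hv : IsRow M n v) : (rowE v).length ≤ n * (2 * (natE M).length + 2) := by
  rw [rowE, length_rawE, ← hv.1]
  have key : ∀ (l : List ℕ), (∀ x ∈ l, x < M) → (l.map fun a => 2 * (natE a).length + 2).sum ≤ l.length * (2 * (natE M).length + 2) := by
    intro l hl
    induction l with
    | nil => simp
    | cons a l ih =>
      rw [List.map_cons, List.sum_cons, List.length_cons, add_one_mul]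
      have ha : (natE a).length ≤ (natE M).length := by
        rw [length_natE, length_natE]; exact Nat.size_le_size (hl a (by simp)).le
      have := ih (fun x hx => hl x (by simp [hx]))
      omega
  exact key v hv.2

/-! ### Vector operations `mod M` -/

/-- `x ↦ (c·x) mod M` as an integer computation: `c x − M ((c x) ediv M)`. [folklore] -/
theorem emod_eq_sub (a : ℤ) (M : ℕ) : a % (M : ℤ) = a - M * (a / M) := Int.emod_def a M

/-- `zmulK (gN N) n c v` on codes (context `(N, c, v)`, budget `1^n`). [cite: AroraBarak2009, §1.3] -/
theorem zmulKC : CodeFP (pairE (pairE natE (pairE intE rowE)) unE) rowE (fun p => zmulK (gN p.1.1) p.2 p.1.2.1 p.1.2.2) := by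
  -- item: `j ↦ ((c * v.getD j 0) % M).toNat` with context `(N, c, v)`
  have hctx : CodeFP (pairE (pairE natE (pairE intE rowE)) natE) (pairE natE (pairE intE rowE)) (fun t => t.1) := fst _ _
  have hj : CodeFP (pairE (pairE natE (pairE intE rowE)) natE) natE (fun t => t.2) := snd _ _
  have hM := natMax.comp (hctx.fst'.pair (const _ (1 : ℕ)))
  have hx := (rawGetOr natE).comp (hctx.snd'.snd'.pair (hj.pair (const _ (0 : ℕ))))
  have hprod := intMul.comp (hctx.snd'.fst'.pair (intOfNat.comp hx))
  have hMi := intOfNat.comp hM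
  have hr := intSub.comp (hprod.pair (intMul.comp (hMi.pair (intEDiv.comp (hprod.pair hMi)))))
  have hitem := intToNat.comp hr
  have hmap := (map hitem).comp ((fst (pairE natE (pairE intE rowE)) unE).pair (urange.comp (snd (pairE natE (pairE intE rowE)) unE)))
  refine hmap.congr fun p => ?_
  rw [zmulK]
  refine List.map_congr_left fun j _ => ?_
  simp only [gN, emod_eq_sub]

/-- `vaddK (gN N) n v w` on codes (context `(N, v, w)`, budget `1^n`). [cite: AroraBarak2009, §1.3] -/
theorem vaddKC : CodeFP (pairE (pairE natE (pairE rowE rowE)) unE) rowE (fun p => vaddK (gN p.1.1) p.2 p.1.2.1 p.1.2.2) := by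
  have hctx : CodeFP (pairE (pairE natE (pairE rowE rowE)) natE) (pairE natE (pairE rowE rowE)) (fun t => t.1) := fst _ _
  have hj : CodeFP (pairE (pairE natE (pairE rowE rowE)) natE) natE (fun t => t.2) := snd _ _
  have hM := natMax.comp (hctx.fst'.pair (const _ (1 : ℕ)))
  have hx := (rawGetOr natE).comp (hctx.snd'.fst'.pair (hj.pair (const _ (0 : ℕ))))
  have hy := (rawGetOr natE).comp (hctx.snd'.snd'.pair (hj.pair (const _ (0 : ℕ))))
  have hitem := natMod.comp ((natAdd.comp (hx.pair hy)).pair hM)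
  have hmap := (map hitem).comp ((fst (pairE natE (pairE rowE rowE)) unE).pair (urange.comp (snd (pairE natE (pairE rowE rowE)) unE)))
  refine hmap.congr fun p => ?_
  rw [vaddK]
  rfl

/-- `bezoutPairN (gN N) n p r` on codes (input `((N, p, r), 1^n)`). [cite: CheungMosca2001, §3] -/
theorem bezoutPairNC : CodeFP (pairE (pairE natE (pairE rowE rowE)) unE) (pairE rowE rowE)
    (fun q => bezoutPairN (gN q.1.1) q.2 q.1.2.1 q.1.2.2) := by
  have hctx : CodeFP (pairE (pairE natE (pairE rowE rowE)) unE) (pairE natE (pairE rowE rowE)) (fun t => t.1) := fst _ _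
  have hn : CodeFP (pairE (pairE natE (pairE rowE rowE)) unE) unE (fun t => t.2) := snd _ _
  have hN := hctx.fst'
  have hp := hctx.snd'.fst'
  have hr := hctx.snd'.snd'
  have ha := (rawGetOr natE).comp (hp.pair ((const _ (0 : ℕ)).pair (const _ (0 : ℕ))))
  have hb := (rawGetOr natE).comp (hr.pair ((const _ (0 : ℕ)).pair (const _ (0 : ℕ))))
  have hg := natGcdABC.comp (ha.pair hb)
  have hgcd := hg.fst'
  have hA := hg.snd'.fst'
  have hB := hg.snd'.snd'
  -- the four scaled rows
  have hz1 := zmulKC.comp ((hN.pair (hA.pair hp)).pair hn)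
  have hz2 := zmulKC.comp ((hN.pair (hB.pair hr)).pair hn)
  have hc3 := intOfNat.comp (natDiv.comp (hb.pair hgcd))
  have hc4 := intNeg.comp (intOfNat.comp (natDiv.comp (ha.pair hgcd)))
  have hz3 := zmulKC.comp ((hN.pair (hc3.pair hp)).pair hn)
  have hz4 := zmulKC.comp ((hN.pair (hc4.pair hr)).pair hn)
  have h1 := vaddKC.comp ((hN.pair (hz1.pair hz2)).pair hn)
  have h2 := vaddKC.comp ((hN.pair (hz3.pair hz4)).pair hn)
  refine (h1.pair h2).congr fun q => ?_
  simp only [bezoutPairN]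

/-! ### The elimination pass as a fold -/

/-- The state of the pass: (pivot flag, pivot, reduced rows). [folklore] -/
abbrev ESt : Type := (Bool × List ℕ) × List (List ℕ)

/-- One step of the pass. [cite: CheungMosca2001, §3] -/
def elimStep (M n : ℕ) (st : ESt) (r : List ℕ) : ESt :=
  if st.1.1 then ((true, (bezoutPairN M n st.1.2 r).1), (bezoutPairN M n st.1.2 r).2 :: st.2)
  else if r.getD 0 0 = 0 then ((false, []), r :: st.2) else ((true, r), st.2)

/-- The state of an optional pivot. [folklore] -/
def stOf (p? : Option (List ℕ)) (rest : List (List ℕ)) : ESt := ((p?.isSome, p?.getD []), rest)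

/-- **The fold of `elimStep` is `elimFoldN`.** [folklore] -/
theorem foldl_elimStep (M n : ℕ) : ∀ (rs : List (List ℕ)) (p? : Option (List ℕ)) (rest : List (List ℕ)),
    rs.foldl (elimStep M n) (stOf p? rest) = stOf (elimFoldN M n p? rest rs).1 (elimFoldN M n p? rest rs).2
  | [], p?, rest => by cases p? <;> rfl
  | r :: rs, none, rest => by
    rw [List.foldl_cons, elimFoldN]
    by_cases h0 : r.getD 0 0 = 0
    · rw [if_pos h0, show elimStep M n (stOf none rest) r = stOf none (r :: rest) by
        unfold elimStep stOf; rw [if_neg (by simp), if_pos h0]; rfl, foldl_elimStep M n rs]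
    · rw [if_neg h0, show elimStep M n (stOf none rest) r = stOf (some r) rest by
        unfold elimStep stOf; rw [if_neg (by simp), if_neg h0]; rfl, foldl_elimStep M n rs]
  | r :: rs, some p, rest => by
    rw [List.foldl_cons, elimFoldN, show elimStep M n (stOf (some p) rest) r =
      stOf (some (bezoutPairN M n p r).1) ((bezoutPairN M n p r).2 :: rest) by simp [elimStep, stOf], foldl_elimStep M n rs]

/-- Every row of the state is an input row or a computed row. [folklore] -/
def StBound (M n : ℕ) (inp : List (List ℕ)) (st : ESt) : Prop :=
  (st.1.2 ∈ inp ∨ IsRow M n st.1.2 ∨ st.1.2 = []) ∧ (∀ v ∈ st.2, v ∈ inp ∨ IsRow M n v) ∧ st.2.length ≤ inp.length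

/-- The bound is kept by the pass (over a prefix of the input). [folklore] -/
theorem stBound_foldl {M : ℕ} [NeZero M] (n : ℕ) (inp : List (List ℕ)) : ∀ (rs : List (List ℕ)) (st : ESt),
    StBound M n inp st → (∀ r ∈ rs, r ∈ inp) → st.2.length + rs.length ≤ inp.length →
      StBound M n inp (rs.foldl (elimStep M n) st)
  | [], st, h, _, _ => h
  | r :: rs, st, h, hrs, hlen => by
    rw [List.foldl_cons]
    have hr : r ∈ inp := hrs r (by simp)
    refine stBound_foldl n inp rs _ ?_ (fun r' hr' => hrs r' (by simp [hr'])) ?_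
    · obtain ⟨h1, h2, h3⟩ := h
      unfold elimStep
      split_ifs with hf h0
      · exact ⟨Or.inr (Or.inl (isRow_bezoutPairN _ _).1), fun v hv => by
          rcases List.mem_cons.1 hv with rfl | hv
          · exact Or.inr (isRow_bezoutPairN _ _).2
          · exact h2 v hv, by simp only [List.length_cons] at hlen ⊢; omega⟩
      · exact ⟨Or.inr (Or.inr rfl), fun v hv => by
          rcases List.mem_cons.1 hv with rfl | hv
          · exact Or.inl hr
          · exact h2 v hv, by simp only [List.length_cons] at hlen ⊢; omega⟩
      · exact ⟨Or.inl hr, h2, by simp only [List.length_cons] at hlen; omega⟩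
    · unfold elimStep
      split_ifs <;> simp only [List.length_cons] at hlen ⊢ <;> omega

/-- `elimStep (gN N) n` on codes (context `(N, 1^n)`). [folklore] -/
theorem elimStepC : CodeFP (pairE (pairE natE unE) (pairE rowE (pairE (pairE bitE rowE) rowsE)))
    (pairE (pairE bitE rowE) rowsE) (fun t => elimStep (gN t.1.1) t.1.2 t.2.2 t.2.1) := by
  have hctx : CodeFP (pairE (pairE natE unE) (pairE rowE (pairE (pairE bitE rowE) rowsE))) (pairE natE unE) (fun t => t.1) := fst _ _
  have hrest : CodeFP (pairE (pairE natE unE) (pairE rowE (pairE (pairE bitE rowE) rowsE))) (pairE rowE (pairE (pairE bitE rowE) rowsE))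
      (fun t => t.2) := snd _ _
  have hr := hrest.fst'
  have hst := hrest.snd'
  have hflag := hst.fst'.fst'
  have hpiv := hst.fst'.snd'
  have hred := hst.snd'
  have hbez := bezoutPairNC.comp ((hctx.fst'.pair (hpiv.pair hr)).pair hctx.snd')
  have htrue : CodeFP (pairE (pairE natE unE) (pairE rowE (pairE (pairE bitE rowE) rowsE))) bitE (fun _ => true) := const _ true
  have hfalse : CodeFP (pairE (pairE natE unE) (pairE rowE (pairE (pairE bitE rowE) rowsE))) bitE (fun _ => false) := const _ false
  have hnil : CodeFP (pairE (pairE natE unE) (pairE rowE (pairE (pairE bitE rowE) rowsE))) rowE (fun _ => ([] : List ℕ)) := const _ ([] : List ℕ)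
  have hb1 := (htrue.pair hbez.fst').pair ((rawCons rowE).comp (hbez.snd'.pair hred))
  have hr0 := (rawGetOr natE).comp (hr.pair ((const _ (0 : ℕ)).pair (const _ (0 : ℕ))))
  have htest := natEq.comp (hr0.pair (const _ (0 : ℕ)))
  have hb2 := (hfalse.pair hnil).pair ((rawCons rowE).comp (hr.pair hred))
  have hb3 := (htrue.pair hr).pair hred
  have h := ite hflag hb1 (ite htest hb2 hb3)
  refine h.congr fun t => ?_
  simp only [elimStep]
  by_cases hf : t.2.2.1.1 = true
  · simp [hf]
  · simp only [hf, Bool.false_eq_true, ↓reduceIte, decide_eq_true_eq]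

/-- **The elimination pass on codes**: `elimFoldN (gN N) n none [] rows` as `(flag, pivot, reduced)`
(context `(N, 1^n)`). [cite: CheungMosca2001, §3; AroraBarak2009, §1.3] -/
theorem elimFoldNC : CodeFP (pairE (pairE natE unE) rowsE) (pairE (pairE bitE rowE) rowsE)
    (fun p => stOf (elimFoldN (gN p.1.1) p.1.2 none [] p.2).1 (elimFoldN (gN p.1.1) p.1.2 none [] p.2).2) := by
  have hinit : CodeFP (pairE natE unE) (pairE (pairE bitE rowE) rowsE) (fun _ => stOf none []) := const _ (stOf none [])
  have h := foldl (σ := ℕ × ℕ) (α := List ℕ) (β := ESt) (eσ := pairE natE unE) (eα := rowE) (eβ := pairE (pairE bitE rowE) rowsE)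
    (step := fun c r st => elimStep (gN c.1) c.2 st r) (init := fun _ => stOf none []) elimStepC hinit
    (C 2 * (X + C 4) * (X + C 4) * (X + C 4)) (fun c l₁ l₂ => by
      haveI : NeZero (gN c.1) := ⟨(gN_pos c.1).ne'⟩
      have hB := stBound_foldl (M := gN c.1) c.2 (l₁ ++ l₂) l₁ (stOf none [])
        ⟨Or.inr (Or.inr rfl), fun v hv => by simp [stOf] at hv, by simp [stOf]⟩ (fun r hr => List.mem_append_left _ hr) (by simp [stOf])
      set st := l₁.foldl (elimStep (gN c.1) c.2) (stOf none [])
      obtain ⟨h1, h2, h3⟩ := hB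
      -- sizes
      have hM : (natE (gN c.1)).length ≤ (natE c.1).length + 1 := by
        rw [length_natE, length_natE]; unfold gN
        rcases Nat.le_total c.1 1 with h | h
        · rw [max_eq_right h]; simp
        · rw [max_eq_left h]; omega
      have hrow : ∀ v, v ∈ l₁ ++ l₂ ∨ IsRow (gN c.1) c.2 v ∨ v = [] →
          (rowE v).length ≤ (rawE rowE (l₁ ++ l₂)).length + c.2 * (2 * (natE c.1).length + 4) := by
        intro v hv
        rcases hv with hv | hv | rfl
        · have := length_item_le_length_rawE rowE hv; omega
        · have hv1 := length_rowE_le hv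
          have hv2 : c.2 * (2 * (natE (gN c.1)).length + 2) ≤ c.2 * (2 * (natE c.1).length + 4) := Nat.mul_le_mul_left _ (by omega)
          omega
        · simp [rowE, rawE]
      have hpiv := hrow st.1.2 h1
      have hred : (rawE rowE st.2).length ≤ st.2.length * (2 * ((rawE rowE (l₁ ++ l₂)).length + c.2 * (2 * (natE c.1).length + 4)) + 2) := by
        have key : ∀ L : List (List ℕ), (∀ v ∈ L, v ∈ l₁ ++ l₂ ∨ IsRow (gN c.1) c.2 v) →
            (rawE rowE L).length ≤ L.length * (2 * ((rawE rowE (l₁ ++ l₂)).length + c.2 * (2 * (natE c.1).length + 4)) + 2) := by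
          intro L hL
          induction L with
          | nil => simp [rawE]
          | cons v L ih =>
            have hv := hrow v ((hL v (by simp)).elim Or.inl (fun h => Or.inr (Or.inl h)))
            have := ih (fun w hw => hL w (by simp [hw]))
            rw [length_rawE, List.map_cons, List.sum_cons, ← length_rawE, List.length_cons, add_one_mul]
            omega
        exact key st.2 h2
      simp only [eval_add, eval_mul, eval_C, eval_X, pairE_apply, length_boolPair]
      have hl : (l₁ ++ l₂).length ≤ (rawE rowE (l₁ ++ l₂)).length := length_le_length_rawE rowE _
      have hu : (unE c.2).length = c.2 := length_unE c.2
      set Xl := 2 * (2 * (natE c.1).length + 2 + (unE c.2).length) + 2 + (rawE rowE (l₁ ++ l₂)).length with hXl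
      have hn : c.2 ≤ Xl := by omega
      have hN4 : 2 * (natE c.1).length + 4 ≤ Xl := by omega
      have hR : (rawE rowE (l₁ ++ l₂)).length ≤ Xl := by omega
      have hb : st.2.length ≤ Xl := h3.trans (hl.trans hR)
      have hQ := Nat.mul_le_mul hn hN4
      have hpiv' : (rowE st.1.2).length ≤ Xl + Xl * Xl := by omega
      have hred' : (rawE rowE st.2).length ≤ Xl * (2 * (Xl + Xl * Xl) + 2) := hred.trans (Nat.mul_le_mul hb (by omega))
      have hbit : (bitE st.1.1).length = 1 := by cases st.1.1 <;> rfl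
      rw [hbit]
      nlinarith [hpiv', hred', Nat.zero_le Xl])
  refine h.congr fun p => ?_
  rw [← foldl_elimStep]


/-! ### Orders: `ordN`, the lcm of a list, `ordVecN`, the complement row -/

/-- `ordN (gN N) a = M / gcd(M, a)` on codes. [folklore] -/
theorem ordNC : CodeFP (pairE natE natE) natE (fun p => ordN (gN p.1) p.2) := by
  have hM := natMax.comp ((fst natE natE).pair (const _ (1 : ℕ)))
  have h := natDiv.comp (hM.pair (natGcdABC.comp (hM.pair (snd natE natE))).fst')
  exact h.congr fun p => rfl

/-- `foldl lcm` is `listLcm` up to the accumulator. [folklore] -/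
theorem foldl_lcm_eq (L : List ℕ) : ∀ a : ℕ, L.foldl Nat.lcm a = Nat.lcm a (Howell.listLcm L) := by
  induction L with
  | nil => intro a; simp [Howell.listLcm]
  | cons x L ih =>
    intro a
    rw [List.foldl_cons, ih]
    show _ = Nat.lcm a (Nat.lcm x (Howell.listLcm L))
    rw [Nat.lcm_assoc]

/-- `size (lcm a b) ≤ size a + size b`. [folklore] -/
theorem size_lcm_le (a b : ℕ) : (Nat.lcm a b).size ≤ a.size + b.size := by
  rcases Nat.eq_zero_or_pos a with rfl | ha
  · simp
  rcases Nat.eq_zero_or_pos b with rfl | hb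
  · simp
  exact (Nat.size_le_size (Nat.le_of_dvd (Nat.mul_pos ha hb) (Nat.lcm_dvd_mul a b))).trans (size_mul_le a b)

/-- The size of a `foldl lcm`. [folklore] -/
theorem size_foldl_lcm_le (L : List ℕ) : ∀ a : ℕ, (L.foldl Nat.lcm a).size ≤ a.size + (rawE natE L).length := by
  induction L with
  | nil => intro a; simp
  | cons x L ih =>
    intro a
    rw [List.foldl_cons, length_rawE, List.map_cons, List.sum_cons, ← length_rawE]
    have h1 := ih (Nat.lcm a x)
    have h2 := size_lcm_le a x
    have h3 : x.size = (natE x).length := (length_natE x).symm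
    omega

/-- **The lcm of a list on codes.** [folklore] -/
theorem listLcmC : CodeFP (rawE natE) natE Howell.listLcm := by
  have hstep : CodeFP (pairE natE natE) natE (fun t => Nat.lcm t.2 t.1) := by
    have hg := (natGcdABC.comp ((snd natE natE).pair (fst natE natE))).fst'
    have h := natDiv.comp ((natMul.comp ((snd natE natE).pair (fst natE natE))).pair hg)
    exact h.congr fun t => rfl
  have h := foldl₀ (eα := natE) (eβ := natE) (step := fun (x : ℕ) (a : ℕ) => Nat.lcm a x) (b₀ := 1) hstep (X + C 1) (fun l₁ l₂ => by
    rw [length_natE, eval_add, eval_X, eval_C]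
    have h1 := size_foldl_lcm_le l₁ 1
    have e : l₁.foldl (fun b a => Nat.lcm b a) 1 = l₁.foldl Nat.lcm 1 := rfl
    rw [e]
    have h2 : (rawE natE l₁).length ≤ (rawE natE (l₁ ++ l₂)).length := by
      rw [length_rawE, length_rawE, List.map_append, List.sum_append]; omega
    have h3 : Nat.size 1 = 1 := rfl
    omega)
  refine h.congr fun L => ?_
  rw [foldl_lcm_eq, Nat.lcm_one_left]

/-- `ordVecN (gN N) v` on codes. [folklore] -/
theorem ordVecNC : CodeFP (pairE natE rowE) natE (fun p => ordVecN (gN p.1) p.2) := by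
  have h := listLcmC.comp ((map ordNC).comp ((fst natE rowE).pair (snd natE rowE)))
  exact h.congr fun p => rfl

/-- `complementRowN (gN N) n p` on codes (input `((N, p), 1^n)`). [folklore] -/
theorem complementRowNC : CodeFP (pairE (pairE natE rowE) unE) rowE (fun q => complementRowN (gN q.1.1) q.2 q.1.2) := by
  have hctx : CodeFP (pairE (pairE natE rowE) unE) (pairE natE rowE) (fun t => t.1) := fst _ _
  have hN := hctx.fst'
  have hp := hctx.snd'
  have h0 := (rawGetOr natE).comp (hp.pair ((const _ (0 : ℕ)).pair (const _ (0 : ℕ))))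
  have hc := intOfNat.comp (ordNC.comp (hN.pair h0))
  have h := zmulKC.comp ((hN.pair (hc.pair hp)).pair (snd (pairE natE rowE) unE))
  exact h.congr fun q => rfl

/-! ### One level of the recursion, and the whole algorithm -/

/-- The state of the recursion: (rows, running product, current width). [folklore] -/
abbrev LSt : Type := List (List ℕ) × ℕ × ℕ

/-- **One level**: eliminate the first column, multiply by the level factor, pass to the tails.
[cite: CheungMosca2001, §3] -/
def levelStepH (M : ℕ) (st : LSt) : LSt :=
  if st.2.2 = 0 then st else
    let e := elimFoldN M st.2.2 none [] st.1
    match e.1 with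
    | none => (e.2.map List.tail, st.2.1, st.2.2 - 1)
    | some p => ((complementRowN M st.2.2 p :: e.2).map List.tail,
        st.2.1 * (ordVecN M p / ordVecN M (complementRowN M st.2.2 p)), st.2.2 - 1)

/-- **The levels compute `subgroupOrderRows`.** [folklore] -/
theorem iterate_levelStepH (M : ℕ) : ∀ (k : ℕ) (rows : List (List ℕ)) (acc : ℕ),
    ((levelStepH M)^[k] (rows, acc, k)).2.1 = acc * subgroupOrderRows M k rows ∧ ((levelStepH M)^[k] (rows, acc, k)).2.2 = 0
  | 0, rows, acc => by simp [subgroupOrderRows]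
  | k + 1, rows, acc => by
    rw [Function.iterate_succ_apply, subgroupOrderRows]
    have hstep : levelStepH M (rows, acc, k + 1) = (match (elimFoldN M (k + 1) none [] rows).1 with
        | none => ((elimFoldN M (k + 1) none [] rows).2.map List.tail, acc, k)
        | some p => ((complementRowN M (k + 1) p :: (elimFoldN M (k + 1) none [] rows).2).map List.tail,
            acc * (ordVecN M p / ordVecN M (complementRowN M (k + 1) p)), k)) := by
      rw [levelStepH, if_neg (Nat.succ_ne_zero k)]
      rfl
    rw [hstep]
    cases (elimFoldN M (k + 1) none [] rows).1 with
    | none => simpa using iterate_levelStepH M k _ acc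
    | some p =>
      obtain ⟨h1, h2⟩ := iterate_levelStepH M k (((complementRowN M (k + 1) p :: (elimFoldN M (k + 1) none [] rows).2).map List.tail))
        (acc * (ordVecN M p / ordVecN M (complementRowN M (k + 1) p)))
      exact ⟨by rw [h1, mul_assoc], h2⟩

/-- Folding a constant step along units is iteration. [folklore] -/
theorem foldl_unit_iterate {β : Type} (F : β → β) (b : β) (l : List Unit) : l.foldl (fun s _ => F s) b = F^[l.length] b := by
  induction l generalizing b with
  | nil => rfl
  | cons _ l ih => rw [List.foldl_cons, ih, List.length_cons, Function.iterate_succ_apply]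

/-- `levelStepH (gN N)` on codes (context `N`; the width travels in unary). [cite: AroraBarak2009, §1.3] -/
theorem levelStepHC : CodeFP (pairE natE (pairE rowsE (pairE natE unE))) (pairE rowsE (pairE natE unE))
    (fun t => levelStepH (gN t.1) t.2) := by
  have hN : CodeFP (pairE natE (pairE rowsE (pairE natE unE))) natE (fun t => t.1) := fst _ _
  have hst : CodeFP (pairE natE (pairE rowsE (pairE natE unE))) (pairE rowsE (pairE natE unE)) (fun t => t.2) := snd _ _
  have hrows := hst.fst'
  have hacc := hst.snd'.fst'
  have hn := hst.snd'.snd'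
  have hzero := natEq.comp ((natOfUn.comp hn).pair (const _ (0 : ℕ)))
  have he := elimFoldNC.comp ((hN.pair hn).pair hrows)
  have hflag := he.fst'.fst'
  have hp := he.fst'.snd'
  have hrest := he.snd'
  have hn' := unOfNatMin.comp (hn.pair (natSub.comp ((natOfUn.comp hn).pair (const _ (1 : ℕ)))))
  have htails_none := (map₀ (rawTail natE)).comp hrest
  have hcomp := complementRowNC.comp ((hN.pair hp).pair hn)
  have htails_some := (map₀ (rawTail natE)).comp ((rawCons rowE).comp (hcomp.pair hrest))
  have hfac := natDiv.comp ((ordVecNC.comp (hN.pair hp)).pair (ordVecNC.comp (hN.pair hcomp)))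
  have hacc' := natMul.comp (hacc.pair hfac)
  have hbnone := htails_none.pair (hacc.pair hn')
  have hbsome := htails_some.pair (hacc'.pair hn')
  have h := ite hzero hst (ite hflag hbsome hbnone)
  refine h.congr fun t => ?_
  obtain ⟨N, rows, acc, n⟩ := t
  dsimp only [id]
  rw [levelStepH]
  by_cases h0 : n = 0
  · subst h0; simp
  · rw [if_neg h0]
    have hmin : min (n - 1) n = n - 1 := min_eq_left (Nat.sub_le n 1)
    simp only [h0, decide_false, Bool.false_eq_true, if_false, hmin]
    cases hq : (elimFoldN (gN N) n none [] rows).1 with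
    | none => simp [stOf]
    | some p => simp [stOf]

/-- Rows of the recursion: the code of every row is bounded by the input rows plus a full computed
row of the initial width. [folklore] -/
def RowBd (M n₀ : ℕ) (inp : List (List ℕ)) (v : List ℕ) : Prop :=
  (rowE v).length ≤ (rawE rowE inp).length + n₀ * (2 * (natE M).length + 2)

/-- Tails keep the bound. [folklore] -/
theorem rowBd_tail {M n₀ : ℕ} {inp : List (List ℕ)} {v : List ℕ} (h : RowBd M n₀ inp v) : RowBd M n₀ inp v.tail := by
  unfold RowBd at *
  refine le_trans ?_ h
  rw [rowE, length_rawE, length_rawE]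
  cases v <;> simp

/-- Computed rows of width `n ≤ n₀` satisfy the bound. [folklore] -/
theorem rowBd_of_isRow {M n₀ n : ℕ} {inp : List (List ℕ)} {v : List ℕ} (hv : IsRow M n v) (hn : n ≤ n₀) : RowBd M n₀ inp v := by
  unfold RowBd
  exact (length_rowE_le hv).trans ((Nat.mul_le_mul_right _ hn).trans (Nat.le_add_left _ _))

/-- Members of the input satisfy the bound. [folklore] -/
theorem rowBd_of_mem {M n₀ : ℕ} {inp : List (List ℕ)} {v : List ℕ} (hv : v ∈ inp) : RowBd M n₀ inp v := by
  unfold RowBd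
  have := length_item_le_length_rawE rowE hv
  omega

/-- The level factor is at most `M`. [folklore] -/
theorem levelFactor_le {M : ℕ} [NeZero M] (n : ℕ) (p : List ℕ) :
    ordVecN M p / ordVecN M (complementRowN M n p) ≤ M := by
  refine (Nat.div_le_self (ordVecN M p) (ordVecN M (complementRowN M n p))).trans
    (Nat.le_of_dvd (Nat.pos_of_ne_zero (NeZero.ne M)) ?_)
  rw [ordVecN, Howell.listLcm_dvd_iff]
  intro x hx
  obtain ⟨a, -, rfl⟩ := List.mem_map.1 hx
  exact Nat.div_dvd_of_dvd (Nat.gcd_dvd_left M a)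

/-- **The invariant of the recursion** (over any number of levels `j`): every row is bounded, the
number of rows grows by at most one per level, the product by a factor `≤ M` per level, the width
decreases. [folklore] -/
theorem levelStepH_invariant {M : ℕ} [NeZero M] (n₀ : ℕ) (inp : List (List ℕ)) (acc₀ : ℕ) : ∀ j : ℕ,
    (∀ v ∈ ((levelStepH M)^[j] (inp, acc₀, n₀)).1, RowBd M n₀ inp v) ∧
      ((levelStepH M)^[j] (inp, acc₀, n₀)).1.length ≤ inp.length + j ∧
      ((levelStepH M)^[j] (inp, acc₀, n₀)).2.1 ≤ acc₀ * M ^ j ∧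
      ((levelStepH M)^[j] (inp, acc₀, n₀)).2.2 ≤ n₀
  | 0 => ⟨fun v hv => rowBd_of_mem hv, by simp, by simp, by simp⟩
  | j + 1 => by
    obtain ⟨h1, h2, h3, h4⟩ := levelStepH_invariant (M := M) n₀ inp acc₀ j
    set st := (levelStepH M)^[j] (inp, acc₀, n₀) with hst
    rw [Function.iterate_succ_apply', ← hst]
    have hM1 : 1 ≤ M := Nat.pos_of_ne_zero (NeZero.ne M)
    have hacc : st.2.1 ≤ acc₀ * M ^ (j + 1) := h3.trans (by rw [pow_succ, ← mul_assoc]; exact Nat.le_mul_of_pos_right _ hM1)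
    by_cases h0 : st.2.2 = 0
    · rw [levelStepH, if_pos h0]; exact ⟨h1, by omega, hacc, h4⟩
    · obtain ⟨n, hn⟩ : ∃ n, st.2.2 = n + 1 := ⟨st.2.2 - 1, by omega⟩
      have hlev : levelStepH M st = (match (elimFoldN M (n + 1) none [] st.1).1 with
          | none => ((elimFoldN M (n + 1) none [] st.1).2.map List.tail, st.2.1, n)
          | some p => ((complementRowN M (n + 1) p :: (elimFoldN M (n + 1) none [] st.1).2).map List.tail,
              st.2.1 * (ordVecN M p / ordVecN M (complementRowN M (n + 1) p)), n)) := by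
        rw [levelStepH, if_neg h0, hn, Nat.add_sub_cancel]
      -- the pass keeps the bound (rows of the pass are state rows or computed rows of width `n + 1 ≤ n₀`)
      have hB := stBound_foldl (M := M) (n + 1) st.1 st.1 (stOf none [])
        ⟨Or.inr (Or.inr rfl), fun v hv => by simp [stOf] at hv, by simp [stOf]⟩ (fun r hr => hr) (by simp [stOf])
      rw [foldl_elimStep] at hB
      obtain ⟨hb1, hb2, hb3⟩ := hB
      simp only [stOf] at hb1 hb2 hb3
      have hn0 : n + 1 ≤ n₀ := hn ▸ h4
      have hrest : ∀ v ∈ (elimFoldN M (n + 1) none [] st.1).2, RowBd M n₀ inp v := fun v hv =>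
        (hb2 v hv).elim (h1 v) (fun h => rowBd_of_isRow h hn0)
      rw [hlev]
      cases hpiv : (elimFoldN M (n + 1) none [] st.1).1 with
      | none =>
        refine ⟨fun v hv => ?_, ?_, hacc, by simp; omega⟩
        · obtain ⟨w, hw, rfl⟩ := List.mem_map.1 hv
          exact rowBd_tail (hrest w hw)
        · simp only [List.length_map]; omega
      | some p =>
        refine ⟨fun v hv => ?_, ?_, ?_, by simp; omega⟩
        · obtain ⟨w, hw, rfl⟩ := List.mem_map.1 hv
          rcases List.mem_cons.1 hw with rfl | hw
          · exact rowBd_tail (rowBd_of_isRow (isRow_zmulK _ _) hn0)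
          · exact rowBd_tail (hrest w hw)
        · simp only [List.length_map, List.length_cons]; omega
        · simp only
          rw [pow_succ, ← mul_assoc]
          exact Nat.mul_le_mul h3 (levelFactor_le _ _)

/-- `normRow (gN N) k r` on codes (input `((N, r), 1^k)`). [folklore] -/
theorem normRowC : CodeFP (pairE (pairE natE rowE) unE) rowE (fun q => normRow (gN q.1.1) q.2 q.1.2) := by
  have hctx : CodeFP (pairE (pairE natE rowE) natE) (pairE natE rowE) (fun t => t.1) := fst _ _
  have hj : CodeFP (pairE (pairE natE rowE) natE) natE (fun t => t.2) := snd _ _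
  have hM := natMax.comp (hctx.fst'.pair (const _ (1 : ℕ)))
  have hx := (rawGetOr natE).comp (hctx.snd'.pair (hj.pair (const _ (0 : ℕ))))
  have hitem := natMod.comp (hx.pair hM)
  have h := (map hitem).comp ((fst (pairE natE rowE) unE).pair (urange.comp (snd (pairE natE rowE) unE)))
  refine h.congr fun q => ?_
  rw [normRow]
  rfl

/-- **The subgroup-order algorithm on codes**: `subgroupOrderPure N k rows` from `(N, 1^k, rows)`.
[cite: CheungMosca2001, §3; AroraBarak2009, §1.3] -/
theorem subgroupOrderPureC : CodeFP (pairE natE (pairE unE rowsE)) natE (fun p => subgroupOrderPure p.1 p.2.1 p.2.2) := by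
  have hN : CodeFP (pairE natE (pairE unE rowsE)) natE (fun t => t.1) := fst _ _
  have hk : CodeFP (pairE natE (pairE unE rowsE)) unE (fun t => t.2.1) := (snd _ _).fst'
  have hrows : CodeFP (pairE natE (pairE unE rowsE)) rowsE (fun t => t.2.2) := (snd _ _).snd'
  -- normalised rows (item map with context `(N, 1^k)`)
  have hnctx : CodeFP (pairE (pairE natE unE) rowE) (pairE (pairE natE rowE) unE) (fun t => ((t.1.1, t.2), t.1.2)) :=
    ((fst _ _).fst'.pair (snd _ _)).pair (fst _ _).snd'
  have hnorm := (map (normRowC.comp hnctx)).comp ((hN.pair hk).pair hrows)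
  -- the levels: fold over `1^k` units
  have hsctx : CodeFP (pairE (pairE natE (pairE rowsE (pairE natE unE))) (pairE unitE (pairE rowsE (pairE natE unE))))
      (pairE natE (pairE rowsE (pairE natE unE))) (fun t => (t.1.1, t.2.2)) := (fst _ _).fst'.pair (snd _ _).snd'
  have hstep := levelStepHC.comp hsctx
  have hinit : CodeFP (pairE natE (pairE rowsE (pairE natE unE))) (pairE rowsE (pairE natE unE)) (fun c => c.2) := snd _ _
  have hfold := foldl (σ := ℕ × (List (List ℕ) × ℕ × ℕ)) (α := Unit) (β := LSt) (eσ := pairE natE (pairE rowsE (pairE natE unE)))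
    (eα := unitE) (eβ := pairE rowsE (pairE natE unE)) (step := fun c _ st => levelStepH (gN c.1) st) (init := fun c => c.2)
    hstep hinit (C 8 * (X + C 2) * (X + C 2) * (X + C 2)) (fun c l₁ l₂ => by
      obtain ⟨N, inp, acc₀, n₀⟩ := c
      haveI : NeZero (gN N) := ⟨(gN_pos N).ne'⟩
      rw [show l₁.foldl (fun st (_ : Unit) => levelStepH (gN N) st) (N, inp, acc₀, n₀).2 = (levelStepH (gN N))^[l₁.length] (inp, acc₀, n₀) from
        foldl_unit_iterate _ _ l₁]
      obtain ⟨h1, h2, h3, h4⟩ := levelStepH_invariant (M := gN N) n₀ inp acc₀ l₁.length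
      set st := (levelStepH (gN N))^[l₁.length] (inp, acc₀, n₀)
      have hM : (natE (gN N)).length ≤ (natE N).length + 1 := by
        rw [length_natE, length_natE]; unfold gN
        rcases Nat.le_total N 1 with h | h
        · rw [max_eq_right h]; simp
        · rw [max_eq_left h]; omega
      -- rows
      have hrows : (rawE rowE st.1).length ≤ st.1.length * (2 * ((rawE rowE inp).length + n₀ * (2 * (natE N).length + 4)) + 2) := by
        have key : ∀ L : List (List ℕ), (∀ v ∈ L, RowBd (gN N) n₀ inp v) →
            (rawE rowE L).length ≤ L.length * (2 * ((rawE rowE inp).length + n₀ * (2 * (natE N).length + 4)) + 2) := by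
          intro L hL
          induction L with
          | nil => simp [rawE]
          | cons v L ih =>
            have hv := hL v (by simp)
            unfold RowBd at hv
            have := ih (fun w hw => hL w (by simp [hw]))
            have hv2 : n₀ * (2 * (natE (gN N)).length + 2) ≤ n₀ * (2 * (natE N).length + 4) := Nat.mul_le_mul_left _ (by omega)
            rw [length_rawE, List.map_cons, List.sum_cons, ← length_rawE, List.length_cons, add_one_mul]
            omega
        exact key st.1 h1
      -- the product
      have hacc : (natE st.2.1).length ≤ (natE acc₀).length + l₁.length * ((natE N).length + 1) + 1 := by
        rw [length_natE, length_natE, length_natE]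
        refine (Nat.size_le_size h3).trans ((size_mul_le _ _).trans ?_)
        have h5 := size_pow_le (gN N) l₁.length
        have h' : (gN N).size ≤ N.size + 1 := by rw [← length_natE, ← length_natE]; exact hM
        have h6 := Nat.mul_le_mul_left l₁.length h'
        omega
      have hw : (unE st.2.2).length ≤ (unE n₀).length := by rw [length_unE, length_unE]; exact h4
      simp only [eval_add, eval_mul, eval_C, eval_X, pairE_apply, length_boolPair]
      set Xl := 2 * (2 * (natE N).length + 2 + (2 * (rawE rowE inp).length + 2 + (2 * (natE acc₀).length + 2 + (unE n₀).length))) + 2 +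
        (rawE unitE (l₁ ++ l₂)).length with hXl
      have hl1 : l₁.length ≤ Xl := by
        have : l₁.length ≤ (rawE unitE (l₁ ++ l₂)).length := (length_le_length_rawE unitE l₁).trans (by
          rw [length_rawE, length_rawE, List.map_append, List.sum_append]; omega)
        omega
      have hn0 : n₀ ≤ Xl := by have := length_unE n₀; omega
      have hlen : st.1.length ≤ Xl + Xl := by
        have : inp.length ≤ (rawE rowE inp).length := length_le_length_rawE rowE inp
        omega
      have hQ := Nat.mul_le_mul hn0 (show 2 * (natE N).length + 4 ≤ Xl by omega)
      have hrows' : (rawE rowE st.1).length ≤ (Xl + Xl) * (2 * (Xl + Xl * Xl) + 2) :=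
        hrows.trans (Nat.mul_le_mul hlen (by omega))
      have hacc' : (natE st.2.1).length ≤ Xl + Xl * Xl + 1 := by
        refine hacc.trans ?_
        have := Nat.mul_le_mul hl1 (show (natE N).length + 1 ≤ Xl by omega)
        omega
      have hw' : (unE st.2.2).length ≤ Xl := hw.trans (by omega)
      try simp only [show rowsE = rawE rowE from rfl]
      nlinarith [hrows', hacc', hw', Nat.zero_le Xl])
  have hone : CodeFP (pairE natE (pairE unE rowsE)) natE (fun _ => (1 : ℕ)) := const _ (1 : ℕ)
  have hrun := hfold.comp ((hN.pair (hnorm.pair (hone.pair hk))).pair (replicateUnit.comp hk))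
  have hres := hrun.snd'.fst'
  have hzero := natEq.comp (hN.pair (const _ (0 : ℕ)))
  have h := ite hzero (const _ (0 : ℕ)) hres
  refine h.congr fun p => ?_
  obtain ⟨N, k, rows⟩ := p
  simp only [subgroupOrderPure]
  by_cases hN0 : N = 0
  · simp [hN0]
  · rw [if_neg hN0]
    simp only [hN0, decide_false, Bool.false_eq_true, ↓reduceIte]
    rw [foldl_unit_iterate, List.length_replicate, (iterate_levelStepH (gN N) k _ 1).1, one_mul, gN_eq hN0]


end HowellFP

end Literature.Computability.Cryptography.Hallgren2005

end
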